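import Mathlib
import Summits.ValiantsHypothesis.ValiantsHypothesis.Theses.DivisionGap
import Literature.Computability.AlgebraicComplexity.MonotoneStructure

/-!
# `TriangularDimersDivisionEasy` — negative-side toolkit 0: the crux's polynomial, unbundled

Crux `stmt-ValiantsHypothesis-5067` (`Theses.DivisionGap.TriangularDimersDivisionEasy`, route
DivisionGap).  Standing disprover (cdisprove gen 1), `Cruxes/TriangularDimersDivisionEasy/Disproof.lean`
§0–§B restated so that the negative lemmas (and planners / provers) can import them.

* §0 `Vtx`, `Var`, `Adj`, `IsDimer`, `dimers n`, `triPM n` (= the crux's inlined `D_n`, doubled edge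
  variables), `bound c n = 2^((log₂ n + c)^c)`, `crux_iff` (`Iff.rfl`), complexity of constants.
* §A the free layers: `even_of_mem_dimers`, `triPM_eq_zero_of_odd`, `clause_of_odd`, `triPM_zero`,
  `clause_zero`, `trivial_without_h_ne_zero` (the side condition `h ≠ 0` is the only thing preventing
  triviality).
* §B `prod_X_eq_monomial`, `dimerExp`, `coeff_triPM` (0/1 coefficients), `mem_support_triPM`,
  `card_support_triPM`, `isFullyOrdered_triPM` — `D_n` is fully ordered with rows = vertices, so the
  tree's structure theorem `ArithCircuit.exists_balanced_decomposition` applies to it verbatim.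
[folklore]
-/

namespace Summit.ValiantsHypothesis.ValiantsHypothesis.Theorems.TriangularDimersDivisionEasy.Negative

open Literature.Computability.AlgebraicComplexity
open MvPolynomial
open scoped BigOperators NNReal

set_option linter.dupNamespace false

noncomputable section

/-! ## §0 Unbundling the crux -/

/-- Vertices of the `n × n` rhombus. -/
abbrev Vtx (n : ℕ) : Type := Fin n × Fin n

/-- Variables of the crux's polynomial ring: ordered pairs of vertices (`x_(v, w)`). -/
abbrev Var (n : ℕ) : Type := Vtx n × Vtx n

/-- Adjacency of the triangular lattice restricted to the rhombus — verbatim the crux's six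
disjuncts (edges `(i,j)–(i+1,j)`, `(i,j)–(i,j+1)`, `(i,j)–(i+1,j-1)`, both orientations). -/
def Adj {n : ℕ} (v w : Vtx n) : Prop :=
  ((v.1 : ℕ) + 1 = w.1 ∧ (v.2 : ℕ) = w.2) ∨ ((w.1 : ℕ) + 1 = v.1 ∧ (v.2 : ℕ) = w.2) ∨
  ((v.1 : ℕ) = w.1 ∧ (v.2 : ℕ) + 1 = w.2) ∨ ((v.1 : ℕ) = w.1 ∧ (w.2 : ℕ) + 1 = v.2) ∨
  ((v.1 : ℕ) + 1 = w.1 ∧ (w.2 : ℕ) + 1 = v.2) ∨ ((w.1 : ℕ) + 1 = v.1 ∧ (v.2 : ℕ) + 1 = w.2)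

/-- Decidability of the adjacency (all disjuncts are equalities of naturals). [folklore] -/
instance {n : ℕ} (v w : Vtx n) : Decidable (Adj v w) := by unfold Adj; infer_instance

/-- A dimer cover (perfect matching) of the rhombus, encoded as in the crux: a fixed-point-free
involution `f` on the vertices with `v` adjacent to `f v`. -/
def IsDimer {n : ℕ} (f : Vtx n → Vtx n) : Prop := ∀ v, f (f v) = v ∧ f v ≠ v ∧ Adj v (f v)

/-- Decidability of the dimer-cover predicate. [folklore] -/
instance {n : ℕ} (f : Vtx n → Vtx n) : Decidable (IsDimer f) := by unfold IsDimer; infer_instance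

/-- The finite set of dimer covers of `R_n`. -/
def dimers (n : ℕ) : Finset (Vtx n → Vtx n) := Finset.univ.filter IsDimer

/-- The crux's polynomial `D_n = Σ_f Π_v x_(v, f v)` (doubled edge variables). -/
def triPM (n : ℕ) : MvPolynomial (Var n) ℝ≥0 :=
  ∑ f ∈ dimers n, ∏ v : Vtx n, X (v, f v)

/-- The crux's threshold `2 ^ ((log₂ n + c) ^ c)`. -/
def bound (c n : ℕ) : ℕ := 2 ^ ((Nat.log 2 n + c) ^ c)

/-- The crux, unbundled (definitional). -/
theorem crux_iff :
    Theses.DivisionGap.TriangularDimersDivisionEasy ↔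
      ∃ c : ℕ, ∀ n : ℕ, ∃ h : MvPolynomial (Var n) ℝ≥0,
        h ≠ 0 ∧ complexity (triPM n * h) + complexity h ≤ bound c n :=
  Iff.rfl

/-- Constants are free in the tree's circuit model. -/
theorem complexity_C_eq_zero {n : ℕ} (a : ℝ≥0) :
    complexity (C a : MvPolynomial (Var n) ℝ≥0) = 0 :=
  complexity_C_holds (σ := Var n) a

/-- The zero polynomial costs no gates. [folklore] -/
@[simp] theorem complexity_zero_eq {n : ℕ} : complexity (0 : MvPolynomial (Var n) ℝ≥0) = 0 := by
  simpa using complexity_C_eq_zero (n := n) 0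

/-- The constant `1` costs no gates. [folklore] -/
@[simp] theorem complexity_one_eq {n : ℕ} : complexity (1 : MvPolynomial (Var n) ℝ≥0) = 0 := by
  simpa using complexity_C_eq_zero (n := n) 1

/-! ## §A Degenerate layers: odd `n` (and `n = 0`) carry no content -/

/-- A dimer cover is a fixed-point-free involution, so it forces `n` to be even. -/
theorem even_of_mem_dimers {n : ℕ} {f : Vtx n → Vtx n} (hf : f ∈ dimers n) : Even n := by
  classical
  rw [dimers, Finset.mem_filter] at hf
  have hd := hf.2
  have hinv : Function.Involutive f := fun v => (hd v).1
  set σ : Equiv.Perm (Vtx n) := hinv.toPerm f with hσ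
  have hσ2 : σ ^ 2 ^ 1 = 1 := by
    rw [pow_one, sq]
    refine Equiv.ext fun v => ?_
    simp [σ, Equiv.Perm.mul_apply, hinv v]
  by_contra hodd
  have hcard : ¬ 2 ∣ Fintype.card (Vtx n) := by
    rw [Fintype.card_prod, Fintype.card_fin]
    intro h2
    exact hodd ((Nat.even_mul.1 (even_iff_two_dvd.2 h2)).elim id id)
  haveI : Fact (Nat.Prime 2) := ⟨Nat.prime_two⟩
  obtain ⟨a, ha⟩ := Equiv.Perm.exists_fixed_point_of_prime hcard hσ2
  exact (hd a).2.1 (by simpa [σ] using ha)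

/-- For odd `n` there is no dimer cover. -/
theorem dimers_eq_empty_of_odd {n : ℕ} (hn : Odd n) : dimers n = ∅ := by
  ext f
  simp only [Finset.notMem_empty, iff_false]
  intro hf
  exact (Nat.not_even_iff_odd.2 hn) (even_of_mem_dimers hf)

/-- For odd `n` the crux's polynomial is `0`. -/
theorem triPM_eq_zero_of_odd {n : ℕ} (hn : Odd n) : triPM n = 0 := by
  rw [triPM, dimers_eq_empty_of_odd hn, Finset.sum_empty]

/-- Hence at odd `n` the crux's `∃ h`-clause holds for EVERY `c` (witness `h = 1`): the statement
has content only at even `n`. -/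
theorem clause_of_odd {n : ℕ} (hn : Odd n) (c : ℕ) :
    ∃ h : MvPolynomial (Var n) ℝ≥0, h ≠ 0 ∧ complexity (triPM n * h) + complexity h ≤ bound c n := by
  refine ⟨1, one_ne_zero, ?_⟩
  rw [triPM_eq_zero_of_odd hn, zero_mul]
  simp

/-- At `n = 0` the polynomial is `1` (the empty cover), so the clause holds for every `c` too. -/
theorem triPM_zero : triPM 0 = 1 := by
  have h1 : ∀ f : Vtx 0 → Vtx 0,
      (∏ v : Vtx 0, (X (v, f v) : MvPolynomial (Var 0) ℝ≥0)) = 1 := fun f =>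
    Fintype.prod_empty _
  have h2 : dimers 0 = Finset.univ := by
    ext f
    simp only [dimers, Finset.mem_filter, Finset.mem_univ, true_and, iff_true]
    intro v; exact v.1.elim0
  simp only [triPM, h1, h2, Finset.sum_const, Finset.card_univ, nsmul_eq_mul, mul_one]
  norm_num [Fintype.card_fun]

/-- At `n = 0` the crux's clause holds for every `c` (witness `h = 1`). [folklore] -/
theorem clause_zero (c : ℕ) :
    ∃ h : MvPolynomial (Var 0) ℝ≥0, h ≠ 0 ∧ complexity (triPM 0 * h) + complexity h ≤ bound c 0 := by
  refine ⟨1, one_ne_zero, ?_⟩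
  rw [triPM_zero, one_mul]
  simp

/-- HYGIENE: the side condition `h ≠ 0` is what keeps the crux non-trivial — with `h = 0` the
clause holds for every `n` and `c`. -/
theorem trivial_without_h_ne_zero :
    ∃ c : ℕ, ∀ n : ℕ, ∃ h : MvPolynomial (Var n) ℝ≥0,
      complexity (triPM n * h) + complexity h ≤ bound c n :=
  ⟨0, fun n => ⟨0, by simp⟩⟩

/-! ## §B The polynomial is fully ordered (rows = vertices): the tree's structure theorem applies -/

/-- The dimer monomial of `f` is the monomial with exponent `Σ_v e_(v, f v)`. -/
theorem prod_X_eq_monomial {n : ℕ} (f : Vtx n → Vtx n) :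
    (∏ v : Vtx n, (X (v, f v) : MvPolynomial (Var n) ℝ≥0)) =
      monomial (∑ v : Vtx n, Finsupp.single (v, f v) 1) 1 := by
  rw [monomial_sum_one]
  rfl

/-- Exponent vector of the dimer cover `f`. -/
abbrev dimerExp {n : ℕ} (f : Vtx n → Vtx n) : Var n →₀ ℕ := ∑ v : Vtx n, Finsupp.single (v, f v) 1

/-- Entries of the exponent of a dimer cover: `1` at `(v, f v)`, `0` elsewhere. [folklore] -/
theorem dimerExp_apply {n : ℕ} (f : Vtx n → Vtx n) (p : Var n) :
    dimerExp f p = if f p.1 = p.2 then 1 else 0 := by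
  classical
  rw [dimerExp, Finsupp.finsetSum_apply, Finset.sum_eq_single p.1]
  · by_cases h : f p.1 = p.2
    · rw [if_pos h, Finsupp.single_apply, if_pos (by rw [h])]
    · rw [if_neg h, Finsupp.single_apply, if_neg]
      intro hp; exact h (by rw [Prod.ext_iff] at hp; exact hp.2)
  · intro v _ hv
    rw [Finsupp.single_apply, if_neg]
    intro hp; exact hv (by rw [Prod.ext_iff] at hp; exact hp.1)
  · intro h; exact absurd (Finset.mem_univ _) h

/-- A dimer cover is determined by its exponent vector. [folklore] -/
theorem dimerExp_injective {n : ℕ} : Function.Injective (dimerExp (n := n)) := by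
  intro f g hfg
  funext v
  have h := congrArg (fun e => e (v, f v)) hfg
  simp only [dimerExp_apply] at h
  by_cases hg : g v = f v
  · exact hg.symm
  · rw [if_neg hg] at h; exact absurd h one_ne_zero

/-- `D_n` as a sum of monomials with coefficient `1`. [folklore] -/
theorem triPM_eq_sum_monomial (n : ℕ) :
    triPM n = ∑ f ∈ dimers n, monomial (dimerExp f) (1 : ℝ≥0) := by
  unfold triPM
  exact Finset.sum_congr rfl fun f _ => prod_X_eq_monomial f

/-- Coefficients of `D_n`: `1` on exponents of dimer covers, `0` elsewhere. -/
theorem coeff_triPM {n : ℕ} (m : Var n →₀ ℕ) :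
    coeff m (triPM n) = if ∃ f ∈ dimers n, dimerExp f = m then 1 else 0 := by
  classical
  rw [triPM_eq_sum_monomial, coeff_sum]
  simp only [coeff_monomial]
  rw [Finset.sum_boole]
  split_ifs with h
  · obtain ⟨f, hf, rfl⟩ := h
    have : (Finset.filter (fun x => dimerExp x = dimerExp f) (dimers n)) = {f} := by
      ext g
      simp only [Finset.mem_filter, Finset.mem_singleton]
      constructor
      · rintro ⟨-, hg⟩; exact dimerExp_injective hg
      · rintro rfl; exact ⟨hf, rfl⟩
    rw [this]; simp
  · have : (Finset.filter (fun x => dimerExp x = m) (dimers n)) = ∅ := by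
      ext g
      simp only [Finset.mem_filter, Finset.notMem_empty, iff_false, not_and]
      exact fun hg hgm => h ⟨g, hg, hgm⟩
    rw [this]; simp

/-- The support of `D_n` consists exactly of the exponents of dimer covers. [folklore] -/
theorem mem_support_triPM {n : ℕ} (m : Var n →₀ ℕ) :
    m ∈ (triPM n).support ↔ ∃ f ∈ dimers n, dimerExp f = m := by
  rw [mem_support_iff, coeff_triPM]
  split_ifs with h <;> simp [h]

/-- The support of `D_n` is in bijection with the dimer covers. -/
theorem card_support_triPM (n : ℕ) : (triPM n).support.card = (dimers n).card := by
  classical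
  have : (triPM n).support = (dimers n).image dimerExp := by
    ext m
    rw [mem_support_triPM, Finset.mem_image]
  rw [this, Finset.card_image_of_injective _ dimerExp_injective]

/-- `D_n` is fully ordered in the sense of `MonotoneStructure` (every monomial has degree exactly
one in each row `v`, the row of the variables `x_(v, ·)`): this is what the doubled-variable
encoding buys — `ArithCircuit.exists_balanced_decomposition` applies to `D_n` verbatim. -/
theorem isFullyOrdered_triPM (n : ℕ) : IsFullyOrdered (triPM n) := by
  classical
  intro m hm i
  obtain ⟨f, -, rfl⟩ := (mem_support_triPM m).1 hm
  rw [dimerExp, rowDegrees, Finsupp.mapDomain_finsetSum]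
  simp only [Finsupp.mapDomain_single]
  rw [Finsupp.finsetSum_apply]
  simp [Finsupp.single_apply]


end

end Summit.ValiantsHypothesis.ValiantsHypothesis.Theorems.TriangularDimersDivisionEasy.Negative
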